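import Literature.Probability.Percolation.UniversalTightness
import Mathlib.Analysis.SpecialFunctions.Pow.Real
import Mathlib.MeasureTheory.Integral.Bochner.Set
import HarnessLib

/-!
# Crux `PercShatteringRace.FreeSusceptibilityPowerSaving` (stmt-CriticalPhenomena-5786), line `bk-hyperscaling-tail-transfer` — stub `stub_typicalMaxBound`

Helper file for the crux skeleton
`Cruxes/FreeSusceptibilityPowerSaving/Lines/bk_hyperscaling_tail_transfer.lean`
(lead prover-line-stmt-CriticalPhenomena-5786-0); proves exactly the registered stub
`stub_typicalMaxBound` (`--supports stmt-CriticalPhenomena-5786`), the "bound on the typical max"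
half of Hutchcroft's BK hyperscaling inequality (PTRF 181 (2021), proof of Thm 2.1/2.5, p. 14):
for the product Bernoulli measure `prodBernoulli w` on the pairs of a countable vertex set `V`, a
finite nonempty `Λ`, `θ ≥ 0`, `A ≥ 1` and `M = typicalMax (prodBernoulli w) Λ` (Hutchcroft's
`M(Λ) = min{n : P(|K_max(Λ)| ≥ n) ≤ e⁻¹}`), a ROOT-UNIFORM tail `P(n ≤ |K_v ∩ Λ|) ≤ A n^{-θ}`
(`v ∈ Λ`, `n ≥ 1`) forces `(M - 1)^{1+θ} ≤ e · A · |Λ|`.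

PROOF (first-moment counting).  Put `n := M - 1 ≥ 1` (`two_le_typicalMax`).  (i) Minimality of
`M`: `e⁻¹ < P(n ≤ |K_max(Λ)|)` (`exp_neg_one_lt_real_of_lt_typicalMax`).  (ii) COUNTING, pointwise:
on `{n ≤ |K_max(Λ)|}` at least `n` roots `v ∈ Λ` have `n ≤ |K_v ∩ Λ|` — the `≥ n` vertices of `Λ`
in the cluster of a maximiser `v⋆` all see the same trace (`clusterCapIn_eq_of_reachable`); so
`n · 𝟙[n ≤ |K_max|] ≤ Σ_{v ∈ Λ} 𝟙[n ≤ |K_v ∩ Λ|]`, and integrating,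
`n · P(n ≤ |K_max|) ≤ Σ_{v ∈ Λ} P(n ≤ |K_v ∩ Λ|) ≤ |Λ| · A · n^{-θ}`.  (iii) Hence
`n e⁻¹ ≤ |Λ| A n^{-θ}`, i.e. `n^{1+θ} = n · n^θ ≤ e A |Λ|`.  No new definitions.
-/

noncomputable section
namespace Summit.CriticalPhenomena.PercolationContinuityZ3.Theorems
open MeasureTheory Finset
open Literature.Probability.Percolation Literature.Probability.LatticeModels

namespace StubTypicalMaxBound

variable {V : Type*}

/-- COUNTING (pointwise): on `{n ≤ |K_max(Λ)|}` at least `n` roots `v ∈ Λ` satisfy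
`n ≤ |K_v ∩ Λ|` — namely the vertices of `Λ` in the cluster of a maximiser.
[cite: Hutchcroft2021, proof of Thm 2.1 (p. 14)] -/
theorem le_card_filter_clusterCapIn_ge {Λ : Finset V} (hΛ : Λ.Nonempty) (ω : BondConfig V)
    {n : ℕ} (hn : n ≤ clusterMaxIn Λ ω) :
    n ≤ (Λ.filter fun v => n ≤ clusterCapIn Λ ω v).card := by
  classical
  obtain ⟨u, hu, hmax⟩ := exists_clusterCapIn_eq_clusterMaxIn hΛ ω
  have h1 : n ≤ clusterCapIn Λ ω u := hmax ▸ hn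
  have h2 := h1
  rw [clusterCapIn_eq] at h2
  refine le_trans h2 (card_le_card fun z hz => ?_)
  rw [mem_filter] at hz ⊢
  exact ⟨hz.1, (clusterCapIn_eq_of_reachable Λ hz.2) ▸ h1⟩

/-- Pointwise first-moment inequality: `n · 𝟙[n ≤ |K_max(Λ)|] ≤ Σ_{v ∈ Λ} 𝟙[n ≤ |K_v ∩ Λ|]`.
[cite: Hutchcroft2021, proof of Thm 2.1 (p. 14)] -/
theorem mul_indicator_le_sum_indicator {Λ : Finset V} (hΛ : Λ.Nonempty) (n : ℕ)
    (ω : BondConfig V) :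
    (n : ℝ) * ({ω : BondConfig V | n ≤ clusterMaxIn Λ ω}).indicator (fun _ => (1 : ℝ)) ω ≤
      ∑ v ∈ Λ, ({ω : BondConfig V | n ≤ clusterCapIn Λ ω v}).indicator (fun _ => (1 : ℝ)) ω := by
  have hsum : ∑ v ∈ Λ, ({ω : BondConfig V | n ≤ clusterCapIn Λ ω v}).indicator
      (fun _ => (1 : ℝ)) ω = ((Λ.filter fun v => n ≤ clusterCapIn Λ ω v).card : ℝ) := by
    rw [natCast_card_filter]
    refine sum_congr rfl fun v _ => ?_
    by_cases h : n ≤ clusterCapIn Λ ω v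
    · rw [if_pos h, Set.indicator_of_mem (show ω ∈ {ω | n ≤ clusterCapIn Λ ω v} from h)]
    · rw [if_neg h, Set.indicator_of_notMem (show ω ∉ {ω | n ≤ clusterCapIn Λ ω v} from h)]
  by_cases h : n ≤ clusterMaxIn Λ ω
  · rw [Set.indicator_of_mem (show ω ∈ {ω | n ≤ clusterMaxIn Λ ω} from h), mul_one, hsum]
    exact_mod_cast le_card_filter_clusterCapIn_ge hΛ ω h
  · rw [Set.indicator_of_notMem (show ω ∉ {ω | n ≤ clusterMaxIn Λ ω} from h), mul_zero]
    exact sum_nonneg fun v _ => Set.indicator_nonneg (fun _ _ => zero_le_one) _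

/-- First moment: `n · P(n ≤ |K_max(Λ)|) ≤ Σ_{v ∈ Λ} P(n ≤ |K_v ∩ Λ|)` (any finite measure,
`V` countable). [cite: Hutchcroft2021, proof of Thm 2.1 (p. 14)] -/
theorem mul_real_clusterMaxIn_ge_le_sum [Countable V] (μ : Measure (BondConfig V))
    [IsFiniteMeasure μ] {Λ : Finset V} (hΛ : Λ.Nonempty) (n : ℕ) :
    (n : ℝ) * μ.real {ω | n ≤ clusterMaxIn Λ ω} ≤
      ∑ v ∈ Λ, μ.real {ω | n ≤ clusterCapIn Λ ω v} := by
  classical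
  have hL : (n : ℝ) * μ.real {ω | n ≤ clusterMaxIn Λ ω} =
      ∫ ω, (n : ℝ) * ({ω : BondConfig V | n ≤ clusterMaxIn Λ ω}).indicator
        (fun _ => (1 : ℝ)) ω ∂μ := by
    rw [integral_const_mul, integral_indicator_const _ (measurableSet_clusterMaxIn_ge Λ n),
      smul_eq_mul, mul_one]
  have hR : ∑ v ∈ Λ, μ.real {ω | n ≤ clusterCapIn Λ ω v} =
      ∫ ω, ∑ v ∈ Λ, ({ω : BondConfig V | n ≤ clusterCapIn Λ ω v}).indicator
        (fun _ => (1 : ℝ)) ω ∂μ := by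
    rw [integral_finsetSum _ fun v _ =>
      (integrable_const (1 : ℝ)).indicator (measurableSet_clusterCapIn_ge Λ v n)]
    refine sum_congr rfl fun v _ => ?_
    rw [integral_indicator_const _ (measurableSet_clusterCapIn_ge Λ v n), smul_eq_mul, mul_one]
  rw [hL, hR]
  refine integral_mono ?_ ?_ fun ω => mul_indicator_le_sum_indicator hΛ n ω
  · exact ((integrable_const (1 : ℝ)).indicator (measurableSet_clusterMaxIn_ge Λ n)).const_mul _
  · exact integrable_finsetSum _ fun v _ =>
      (integrable_const (1 : ℝ)).indicator (measurableSet_clusterCapIn_ge Λ v n)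

end StubTypicalMaxBound

/-- **stub_typicalMaxBound (Hutchcroft 2021, proof of Thm 2.1/2.5 — the bound on the typical max
cluster size `M = typicalMax (prodBernoulli w) Λ` from a ROOT-UNIFORM tail).**
For every countable `V`, weight `w : Sym2 V → [0,1]`, finite NONEMPTY `Λ`, `θ ≥ 0`, `A ≥ 1`: if
`P(n ≤ |K_v ∩ Λ|) ≤ A n^{-θ}` for all `v ∈ Λ` and integers `n ≥ 1`, then
`(M - 1)^{1+θ} ≤ e · A · |Λ|` (real power `Real.rpow`).  First-moment proof: with `n = M - 1`,
`n e⁻¹ < n P(n ≤ |K_max|) ≤ Σ_{v ∈ Λ} P(n ≤ |K_v ∩ Λ|) ≤ |Λ| A n^{-θ}`.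
[cite: Hutchcroft2021, proof of Thm 2.1/2.5 (p. 14) and §2.1 (typical value M)] -/
theorem stub_typicalMaxBound :
    ∀ (V : Type) [Countable V] (w : Sym2 V → unitInterval) (Λ : Finset V) (θ A : ℝ),
      0 ≤ θ → 1 ≤ A → Λ.Nonempty →
      (∀ v ∈ Λ, ∀ n : ℕ, 1 ≤ n →
        (prodBernoulli w).real {ω | n ≤ clusterCapIn Λ ω v} ≤ A * (n : ℝ) ^ (-θ)) →
      ((typicalMax (prodBernoulli w) Λ : ℝ) - 1) ^ (1 + θ) ≤ Real.exp 1 * A * (Λ.card : ℝ) := by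
  intro V _ w Λ θ A hθ _hA hΛ htail
  have hM2 : 2 ≤ typicalMax (prodBernoulli w) Λ := two_le_typicalMax (prodBernoulli w) hΛ
  set n := typicalMax (prodBernoulli w) Λ - 1 with hn
  have hn1 : 1 ≤ n := by omega
  have hnM : n < typicalMax (prodBernoulli w) Λ := by omega
  have hcast : ((typicalMax (prodBernoulli w) Λ : ℝ) - 1) = (n : ℝ) := by
    rw [hn, Nat.cast_pred (by omega)]
  have hn0 : (0 : ℝ) < n := by exact_mod_cast hn1
  have hnθ : 0 < (n : ℝ) ^ θ := Real.rpow_pos_of_pos hn0 θ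
  have hexp : 0 < Real.exp 1 := Real.exp_pos 1
  -- (i) minimality of the typical value
  have h1 : Real.exp (-1) < (prodBernoulli w).real {ω | n ≤ clusterMaxIn Λ ω} :=
    exp_neg_one_lt_real_of_lt_typicalMax (prodBernoulli w) Λ hnM
  -- (ii) first moment
  have h2 : (n : ℝ) * (prodBernoulli w).real {ω | n ≤ clusterMaxIn Λ ω} ≤
      ∑ v ∈ Λ, (prodBernoulli w).real {ω | n ≤ clusterCapIn Λ ω v} :=
    StubTypicalMaxBound.mul_real_clusterMaxIn_ge_le_sum (prodBernoulli w) hΛ n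
  -- the tail hypothesis at every root of `Λ`
  have h3 : ∑ v ∈ Λ, (prodBernoulli w).real {ω | n ≤ clusterCapIn Λ ω v} ≤
      (Λ.card : ℝ) * (A * (n : ℝ) ^ (-θ)) := by
    rw [← nsmul_eq_mul, ← sum_const]
    exact sum_le_sum fun v hv => htail v hv n hn1
  -- (iii) `n e⁻¹ ≤ |Λ| A n^{-θ}`
  have h4 : (n : ℝ) * (Real.exp 1)⁻¹ ≤ (Λ.card : ℝ) * (A * ((n : ℝ) ^ θ)⁻¹) := by
    rw [← Real.exp_neg, ← Real.rpow_neg hn0.le]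
    calc (n : ℝ) * Real.exp (-1)
        ≤ (n : ℝ) * (prodBernoulli w).real {ω | n ≤ clusterMaxIn Λ ω} :=
          mul_le_mul_of_nonneg_left h1.le hn0.le
      _ ≤ _ := h2
      _ ≤ _ := h3
  rw [hcast, Real.rpow_one_add' hn0.le (by linarith)]
  have h5 := mul_le_mul_of_nonneg_right h4 (mul_nonneg hexp.le hnθ.le)
  have lhs : (n : ℝ) * (Real.exp 1)⁻¹ * (Real.exp 1 * (n : ℝ) ^ θ) = n * (n : ℝ) ^ θ := by
    field_simp
  have rhs : (Λ.card : ℝ) * (A * ((n : ℝ) ^ θ)⁻¹) * (Real.exp 1 * (n : ℝ) ^ θ) =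
      Real.exp 1 * A * Λ.card := by
    field_simp
  linarith

end Summit.CriticalPhenomena.PercolationContinuityZ3.Theorems
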